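/-
Copyright (c) 2026. All rights reserved.
Released under Apache 2.0 license as described in the file LICENSE.
Authors: abc-iut cell, seat abc-iut-w5-d169 (gen 16; row «PL2-LEAF-2», optional leaf (Prim), part 1).
-/
import Literature.AnabelianGeometry.EtaleTheta.ZHatLevelDetermination
import Mathlib.Data.Nat.Factorization.Basic
import Mathlib.FieldTheory.Finite.Basic
import HarnessLib

/-!
# The primary idempotents `e_ℓ ∈ Ẑ = ∏_ℓ ℤ_ℓ` by their levels

Ribes–Zalesskii, *Profinite Groups* (2nd ed. 2010), Thm 2.7.1 (`Ẑ = lim ℤ/nℤ`) and Thm 2.7.2 (a procyclic group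
is the product of its `ℓ`-Sylow subgroups; `Ẑ ≅ ∏_ℓ ℤ_ℓ`) [cite: RibesZalesskii2010, Thm 2.7.1]
[cite: RibesZalesskii2010, Thm 2.7.2], over Mathlib's `ProfiniteGrp.ProfiniteCompletion.completion
(GrpCat.of (Multiplicative ℤ))` and the level characters `ZHatLevel.level n : Ẑ → ℤ/nℤ`, compatible families
`ZHatLevel.LevelFamily` and `ZHatLevel.powEnd` of `CyclotomeZHatAction.lean` / `ZHatLevelDetermination.lean`.

DEFINITION + PROOF file (two named definitions, no instance, no notation), abc-iut cell layer L6, seat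
abc-iut-w5-d169 (gen 16), row PL2-LEAF-2 (optional leaf (Prim) of programme P-L2, rung (L2-T), part 1 — the
`Ẑ`-side of the primary decomposition `w = ∏_ℓ w^{e_ℓ}` of an element of a profinite group):

* `ZHatLevel.primaryIdemNat ℓ n = (n / ℓ^{v_ℓ(n)}) ^ φ(ℓ^{v_ℓ(n)})` — an explicit natural number representing the
  CRT idempotent of `ℤ/nℤ = ℤ/ℓ^{v} × ℤ/(n/ℓ^{v})` that is `1` on the `ℓ`-part and `0` on the `ℓ`-free part
  (`primaryIdemNat_modEq_one`, `ordCompl_dvd_primaryIdemNat`; Euler's theorem); compatible under `ℤ/N → ℤ/n`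
  for `n ∣ N` (`primaryIdemNat_modEq_of_dvd`), whence the compatible family `ZHatLevel.primaryIdemFamily ℓ` and
* **`ZHatLevel.primaryIdem ℓ : Ẑ`** — the `ℓ`-PRIMARY IDEMPOTENT `e_ℓ = (…, 0, 1, 0, …) ∈ ∏ ℤ_p`, with its levels
  `toAdd_level_primaryIdem` (`e_ℓ mod n = primaryIdemNat ℓ n`), `natCast_primaryIdemNat_eq_zero_of_not_dvd`
  (`e_ℓ ≡ 0 (mod n)` if `ℓ ∤ n`), `primaryIdemNat_prime_pow` (`e_ℓ ≡ 1 (mod ℓ^k)`), `primaryIdem_ne_one`;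
* `pow_val_level_primaryIdem_pow_eq_one` — in ANY monoid, if `q^n = 1` then `q^{e_ℓ mod n}` has `ℓ`-power order
  (it is the `ℓ`-primary component of `q`);
* **`sum_natCast_primaryIdemNat`** — `Σ_{ℓ ∣ n} e_ℓ ≡ 1 (mod n)` (checked prime power by prime power), and its
  consequence `exists_mem_level_eq_of_forall_primaryIdem_mem`: a subgroup of `Ẑ` containing every `e_ℓ` meets
  every level class of `η(1)` (the finite step of «the closed subgroup generated by the `e_ℓ` is `Ẑ`», completed by
  compactness in `SettingModelPrimaryDecomposition.lean`).
Classical profinite / elementary number theory; nothing here bears on [IUTchIII] Cor. 3.12.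
-/

noncomputable section

open CategoryTheory ProfiniteGrp ProfiniteGrp.ProfiniteCompletion

namespace Literature.AnabelianGeometry.EtaleTheta.ZHatLevel

/-! ### The CRT idempotents of `ℤ/nℤ` as natural numbers -/

/-- **`primaryIdemNat ℓ n = (n / ℓ^{v_ℓ(n)}) ^ φ(ℓ^{v_ℓ(n)})`**: a natural number which is `≡ 1 (mod ℓ^{v_ℓ(n)})`
(Euler) and `≡ 0 (mod n / ℓ^{v_ℓ(n)})`, i.e. a representative of the idempotent of `ℤ/nℤ ≅ ℤ/ℓ^{v} × ℤ/(n/ℓ^{v})`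
cutting out the `ℓ`-primary factor. [cite: RibesZalesskii2010, Thm 2.7.2] -/
def primaryIdemNat (ℓ n : ℕ) : ℕ := (ordCompl[ℓ] n) ^ Nat.totient (ordProj[ℓ] n)

/-- The `ℓ`-free part of `n` divides `primaryIdemNat ℓ n` (`φ ≥ 1`). [cite: RibesZalesskii2010, Thm 2.7.2] -/
theorem ordCompl_dvd_primaryIdemNat (ℓ n : ℕ) : ordCompl[ℓ] n ∣ primaryIdemNat ℓ n :=
  dvd_pow_self _ (Nat.totient_pos.2 (Nat.ordProj_pos n ℓ)).ne'

/-- The `ℓ`-part and the `ℓ`-free part of `n ≠ 0` are coprime. [cite: RibesZalesskii2010, Thm 2.7.2] -/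
theorem coprime_ordProj_ordCompl (ℓ : ℕ) {n : ℕ} (hn : n ≠ 0) : Nat.Coprime (ordProj[ℓ] n) (ordCompl[ℓ] n) := by
  by_cases hℓ : ℓ.Prime
  · exact (Nat.coprime_ordCompl hℓ hn).pow_left _
  · rw [Nat.factorization_eq_zero_of_not_prime n hℓ, pow_zero]
    exact Nat.coprime_one_left _

/-- **Euler**: `primaryIdemNat ℓ n ≡ 1 (mod ℓ^{v_ℓ(n)})`. [cite: RibesZalesskii2010, Thm 2.7.2] -/
theorem primaryIdemNat_modEq_one (ℓ : ℕ) {n : ℕ} (hn : n ≠ 0) : primaryIdemNat ℓ n ≡ 1 [MOD ordProj[ℓ] n] :=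
  Nat.ModEq.pow_totient (coprime_ordProj_ordCompl ℓ hn).symm

/-- **Compatibility**: for `n ∣ N ≠ 0`, `primaryIdemNat ℓ N ≡ primaryIdemNat ℓ n (mod n)` (both are `≡ 1` modulo
the `ℓ`-part of `n` and `≡ 0` modulo its `ℓ`-free part; Chinese remainder). [cite: RibesZalesskii2010, Thm 2.7.2] -/
theorem primaryIdemNat_modEq_of_dvd (ℓ : ℕ) {n N : ℕ} (hN : N ≠ 0) (h : n ∣ N) :
    primaryIdemNat ℓ N ≡ primaryIdemNat ℓ n [MOD n] := by
  have hn : n ≠ 0 := fun hn => hN (Nat.eq_zero_of_zero_dvd (hn ▸ h))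
  have h1 : primaryIdemNat ℓ N ≡ primaryIdemNat ℓ n [MOD ordProj[ℓ] n] :=
    ((primaryIdemNat_modEq_one ℓ hN).of_dvd (Nat.ordProj_dvd_ordProj_of_dvd hN h ℓ)).trans
      (primaryIdemNat_modEq_one ℓ hn).symm
  have h2 : primaryIdemNat ℓ N ≡ primaryIdemNat ℓ n [MOD ordCompl[ℓ] n] :=
    (Nat.modEq_zero_iff_dvd.2 ((Nat.ordCompl_dvd_ordCompl_of_dvd h ℓ).trans
      (ordCompl_dvd_primaryIdemNat ℓ N))).trans
      (Nat.modEq_zero_iff_dvd.2 (ordCompl_dvd_primaryIdemNat ℓ n)).symm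
  have h12 := (Nat.modEq_and_modEq_iff_modEq_mul (coprime_ordProj_ordCompl ℓ hn)).1 ⟨h1, h2⟩
  rwa [Nat.ordProj_mul_ordCompl_eq_self] at h12

/-- `n` divides `ℓ^{v_ℓ(n)} · primaryIdemNat ℓ n` (and hence `ℓ^{v_ℓ(n)} · (primaryIdemNat ℓ n mod n)`): the
idempotent kills the `ℓ`-free part. [cite: RibesZalesskii2010, Thm 2.7.2] -/
theorem dvd_ordProj_mul_primaryIdemNat_mod (ℓ n : ℕ) : n ∣ ordProj[ℓ] n * (primaryIdemNat ℓ n % n) := by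
  conv_lhs => rw [← Nat.ordProj_mul_ordCompl_eq_self n ℓ]
  exact Nat.mul_dvd_mul_left _
    ((Nat.dvd_mod_iff (Nat.ordCompl_dvd n ℓ)).2 (ordCompl_dvd_primaryIdemNat ℓ n))

/-- At a prime power level `ℓ^k` (`ℓ` prime) the idempotent is `1`. [cite: RibesZalesskii2010, Thm 2.7.2] -/
theorem primaryIdemNat_prime_pow {ℓ : ℕ} (hℓ : ℓ.Prime) (k : ℕ) : primaryIdemNat ℓ (ℓ ^ k) = 1 := by
  rw [primaryIdemNat, hℓ.factorization_pow, Finsupp.single_eq_same, Nat.div_self (pow_pos hℓ.pos k), one_pow]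

/-- At a level `n` not divisible by `ℓ` the idempotent is `≡ 0 (mod n)`.
[cite: RibesZalesskii2010, Thm 2.7.2] -/
theorem natCast_primaryIdemNat_eq_zero_of_not_dvd {ℓ n : ℕ} (h : ¬ ℓ ∣ n) :
    (primaryIdemNat ℓ n : ZMod n) = 0 := by
  rw [ZMod.natCast_eq_zero_iff]
  refine dvd_trans ?_ (ordCompl_dvd_primaryIdemNat ℓ n)
  rw [Nat.factorization_eq_zero_of_not_dvd h, pow_zero, Nat.div_one]

/-- For distinct primes `p ≠ ℓ`, the `p`-part of `n` divides the `ℓ`-free part of `n`.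
[cite: RibesZalesskii2010, Thm 2.7.2] -/
theorem ordProj_dvd_ordCompl_of_ne {p ℓ n : ℕ} (hp : p.Prime) (hne : p ≠ ℓ) (hn : n ≠ 0) :
    ordProj[p] n ∣ ordCompl[ℓ] n := by
  rw [hp.pow_dvd_iff_le_factorization (Nat.ordCompl_pos ℓ hn).ne', Nat.factorization_ordCompl,
    Finsupp.erase_ne hne]

/-- A natural number divisible by every prime-power part of `n ≠ 0` is divisible by `n`. [folklore] -/
private theorem dvd_of_forall_ordProj_dvd {n y : ℕ} (hn : n ≠ 0) (h : ∀ p : ℕ, p.Prime → ordProj[p] n ∣ y) :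
    n ∣ y := by
  by_cases hy : y = 0
  · rw [hy]; exact dvd_zero n
  refine (Nat.factorization_le_iff_dvd hn hy).1 fun p => ?_
  by_cases hp : p.Prime
  · exact (hp.pow_dvd_iff_le_factorization hy).1 (h p hp)
  · rw [Nat.factorization_eq_zero_of_not_prime n hp]; exact Nat.zero_le _

/-- **`Σ_{ℓ ∣ n} e_ℓ ≡ 1 (mod n)`**: the primary idempotents at level `n` sum to `1` in `ℤ/nℤ` (modulo each `p^{v_p(n)}`
exactly the summand `ℓ = p` is `1` and the others vanish). [cite: RibesZalesskii2010, Thm 2.7.2] -/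
theorem sum_natCast_primaryIdemNat (n : ℕ) (hn : n ≠ 0) :
    ∑ ℓ ∈ n.primeFactors, (primaryIdemNat ℓ n : ZMod n) = 1 := by
  haveI : NeZero n := ⟨hn⟩
  rw [← sub_eq_zero]
  set y : ZMod n := ∑ ℓ ∈ n.primeFactors, (primaryIdemNat ℓ n : ZMod n) - 1 with hy
  rw [← ZMod.val_eq_zero]
  refine Nat.eq_zero_of_dvd_of_lt (dvd_of_forall_ordProj_dvd hn fun p hp => ?_) (ZMod.val_lt y)
  by_cases hv : n.factorization p = 0
  · rw [hv, pow_zero]; exact one_dvd _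
  have hpn : p ∈ n.primeFactors := Nat.mem_primeFactors.2 ⟨hp, Nat.dvd_of_factorization_pos hv, hn⟩
  have hdvd : ordProj[p] n ∣ n := Nat.ordProj_dvd n p
  -- read `y` modulo `p^{v_p(n)}`
  rw [← ZMod.natCast_eq_zero_iff, ← ZMod.cast_eq_val, ← ZMod.castHom_apply (h := hdvd) (R := ZMod (ordProj[p] n))]
  rw [hy, map_sub, map_one, map_sum, sub_eq_zero, Finset.sum_eq_single_of_mem p hpn]
  · rw [map_natCast, (ZMod.natCast_eq_natCast_iff _ _ _).2 (primaryIdemNat_modEq_one p hn), Nat.cast_one]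
  · intro ℓ hℓ hne
    rw [map_natCast, ZMod.natCast_eq_zero_iff]
    exact (ordProj_dvd_ordCompl_of_ne hp hne.symm hn).trans (ordCompl_dvd_primaryIdemNat ℓ n)

/-! ### The primary idempotents `e_ℓ ∈ Ẑ` -/

/-- The compatible family `(primaryIdemNat ℓ n mod n)_n` — the levels of the `ℓ`-primary idempotent.
[cite: RibesZalesskii2010, Thm 2.7.2] -/
def primaryIdemFamily (ℓ : ℕ) : LevelFamily where
  c n := (primaryIdemNat ℓ n : ZMod n)
  compat n N h := by
    rw [map_natCast]
    exact (ZMod.natCast_eq_natCast_iff _ _ _).2 (primaryIdemNat_modEq_of_dvd ℓ N.ne_zero h)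

/-- [cite: RibesZalesskii2010, Thm 2.7.2] -/
@[simp] theorem primaryIdemFamily_c (ℓ : ℕ) (n : ℕ+) :
    (primaryIdemFamily ℓ).c n = (primaryIdemNat ℓ n : ZMod n) := rfl

/-- **The `ℓ`-primary idempotent `e_ℓ ∈ Ẑ`** (`= (0, …, 0, 1, 0, …)` under `Ẑ ≅ ∏_p ℤ_p`, the `1` in the factor
`ℤ_ℓ`): the image of `η(1)` under the endomorphism `x ↦ x^{c}` of `Ẑ` attached to the compatible family
`c = primaryIdemFamily ℓ`. [cite: RibesZalesskii2010, Thm 2.7.2] -/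
def primaryIdem (ℓ : ℕ) : completion (GrpCat.of (Multiplicative ℤ)) := powEnd (primaryIdemFamily ℓ) (eta 1)

/-- **Levels of `e_ℓ`**: `e_ℓ mod n = primaryIdemNat ℓ n`. [cite: RibesZalesskii2010, Thm 2.7.2] -/
theorem toAdd_level_primaryIdem (ℓ : ℕ) (n : ℕ+) :
    Multiplicative.toAdd (level n (primaryIdem ℓ)) = (primaryIdemNat ℓ n : ZMod n) := by
  rw [primaryIdem, toAdd_level_powEnd, level_eta, toAdd_ofAdd, Int.cast_one, mul_one, primaryIdemFamily_c]

/-- `(e_ℓ mod n).val = primaryIdemNat ℓ n % n`. [cite: RibesZalesskii2010, Thm 2.7.2] -/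
theorem val_level_primaryIdem (ℓ : ℕ) (n : ℕ+) :
    (Multiplicative.toAdd (level n (primaryIdem ℓ))).val = primaryIdemNat ℓ n % n := by
  rw [toAdd_level_primaryIdem, ZMod.val_natCast]

/-- `e_ℓ ≡ 1 (mod ℓ^k)` for `ℓ` prime. [cite: RibesZalesskii2010, Thm 2.7.2] -/
theorem toAdd_level_primaryIdem_prime_pow {ℓ : ℕ} (hℓ : ℓ.Prime) (k : ℕ) (n : ℕ+) (hn : (n : ℕ) = ℓ ^ k) :
    Multiplicative.toAdd (level n (primaryIdem ℓ)) = 1 := by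
  rw [toAdd_level_primaryIdem, hn, primaryIdemNat_prime_pow hℓ, Nat.cast_one]

/-- `e_ℓ ≡ 0 (mod n)` when `ℓ ∤ n`. [cite: RibesZalesskii2010, Thm 2.7.2] -/
theorem level_primaryIdem_eq_one_of_not_dvd (ℓ : ℕ) (n : ℕ+) (h : ¬ ℓ ∣ (n : ℕ)) :
    level n (primaryIdem ℓ) = 1 := by
  rw [← ofAdd_toAdd (level n (primaryIdem ℓ)), toAdd_level_primaryIdem,
    natCast_primaryIdemNat_eq_zero_of_not_dvd h, ofAdd_zero]

/-- `e_ℓ ≠ 1` in `Ẑ` (i.e. `e_ℓ ≠ 0` additively) for `ℓ` prime: its level-`ℓ` value is `1 ≠ 0`.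
[cite: RibesZalesskii2010, Thm 2.7.2] -/
theorem primaryIdem_ne_one {ℓ : ℕ} (hℓ : ℓ.Prime) : primaryIdem ℓ ≠ 1 := by
  intro h
  have h1 := toAdd_level_primaryIdem_prime_pow hℓ 1 ⟨ℓ, hℓ.pos⟩ (by rw [PNat.mk_coe, pow_one])
  rw [h, map_one, toAdd_one, eq_comm, ← Nat.cast_one, ZMod.natCast_eq_zero_iff, PNat.mk_coe,
    Nat.dvd_one] at h1
  exact hℓ.one_lt.ne' h1

/-- **`q^{e_ℓ}` has `ℓ`-power order**: in any monoid, if `q^n = 1` then `(q^{(e_ℓ mod n)})^{ℓ^{v_ℓ(n)}} = 1` — so at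
every finite level the `e_ℓ`-th power is the `ℓ`-primary component. [cite: RibesZalesskii2010, Thm 2.7.2] -/
theorem pow_val_level_primaryIdem_pow_eq_one {M : Type*} [Monoid M] {q : M} {n : ℕ+} (hq : q ^ (n : ℕ) = 1)
    (ℓ : ℕ) : (q ^ (Multiplicative.toAdd (level n (primaryIdem ℓ))).val) ^ (ℓ ^ (n : ℕ).factorization ℓ) = 1 := by
  obtain ⟨t, ht⟩ := dvd_ordProj_mul_primaryIdemNat_mod ℓ (n : ℕ)
  rw [val_level_primaryIdem, ← pow_mul, mul_comm, ht, pow_mul, hq, one_pow]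

/-- Hence for `ℓ` prime, `q^{e_ℓ}` has order `ℓ^j` for some `j`. [cite: RibesZalesskii2010, Thm 2.7.2] -/
theorem exists_pow_val_level_primaryIdem_pow_prime_pow_eq_one {M : Type*} [Monoid M] {q : M} {n : ℕ+}
    (hq : q ^ (n : ℕ) = 1) (ℓ : ℕ) :
    ∃ j : ℕ, (q ^ (Multiplicative.toAdd (level n (primaryIdem ℓ))).val) ^ ℓ ^ j = 1 :=
  ⟨(n : ℕ).factorization ℓ, pow_val_level_primaryIdem_pow_eq_one hq ℓ⟩

/-! ### `Σ_ℓ e_ℓ = 1` at every level, and subgroups containing the idempotents -/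

/-- **`∏_{ℓ ∣ n} (e_ℓ mod n) = 1 mod n`** (multiplicative spelling of `Σ e_ℓ ≡ 1`): the level-`n` value of `η(1)`
is recovered from the idempotents of the primes dividing `n`. [cite: RibesZalesskii2010, Thm 2.7.2] -/
theorem sum_toAdd_level_primaryIdem (n : ℕ+) :
    ∑ ℓ ∈ (n : ℕ).primeFactors, Multiplicative.toAdd (level n (primaryIdem ℓ)) =
      Multiplicative.toAdd (level n (eta 1)) := by
  simp only [toAdd_level_primaryIdem]
  rw [sum_natCast_primaryIdemNat n n.ne_zero, level_eta, toAdd_ofAdd, Int.cast_one]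

/-- A subgroup of `Ẑ` containing the idempotents `e_ℓ`, `ℓ ∈ F`, contains an element whose levels are
`Σ_{ℓ ∈ F} e_ℓ mod n` (induction on the finite set `F`). [cite: RibesZalesskii2010, Thm 2.7.2] -/
theorem exists_mem_toAdd_level_eq_sum (S : Subgroup (completion (GrpCat.of (Multiplicative ℤ))))
    (F : Finset ℕ) (hS : ∀ ℓ ∈ F, primaryIdem ℓ ∈ S) (n : ℕ+) :
    ∃ s ∈ S, Multiplicative.toAdd (level n s) =
      ∑ ℓ ∈ F, Multiplicative.toAdd (level n (primaryIdem ℓ)) := by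
  classical
  induction F using Finset.induction_on with
  | empty => exact ⟨1, S.one_mem, by rw [map_one, toAdd_one, Finset.sum_empty]⟩
  | insert ℓ F hℓF ih =>
    obtain ⟨s, hs, hsum⟩ := ih fun ℓ' hℓ' => hS ℓ' (Finset.mem_insert_of_mem hℓ')
    refine ⟨primaryIdem ℓ * s, S.mul_mem (hS ℓ (Finset.mem_insert_self ℓ F)) hs, ?_⟩
    rw [map_mul, toAdd_mul, hsum, Finset.sum_insert hℓF]

/-- **A subgroup of `Ẑ` containing every primary idempotent `e_ℓ` (`ℓ` prime) meets every level class of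
`η(1)`**: for each `n ≥ 1` it contains an `s` with `s ≡ η(1) (mod n)`.  (With compactness — `Ẑ` profinite, the
classes `mod n` a neighbourhood basis — a CLOSED such subgroup contains `η(1)`, hence is all of `Ẑ`: this last step
is taken in `SettingModelPrimaryDecomposition.lean`.) [cite: RibesZalesskii2010, Thm 2.7.2] -/
theorem exists_mem_level_eq_of_forall_primaryIdem_mem (S : Subgroup (completion (GrpCat.of (Multiplicative ℤ))))
    (hS : ∀ ℓ : ℕ, ℓ.Prime → primaryIdem ℓ ∈ S) (n : ℕ+) : ∃ s ∈ S, level n s = level n (eta 1) := by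
  obtain ⟨s, hs, hsum⟩ := exists_mem_toAdd_level_eq_sum S (n : ℕ).primeFactors
    (fun ℓ hℓ => hS ℓ (Nat.prime_of_mem_primeFactors hℓ)) n
  refine ⟨s, hs, Multiplicative.toAdd.injective ?_⟩
  rw [hsum, sum_toAdd_level_primaryIdem]

end Literature.AnabelianGeometry.EtaleTheta.ZHatLevel

end
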